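import Summits.KontsevichZagierPeriods.KontsevichZagierPeriods.Theses.SymplecticScissors
import Literature.NumberTheory.Transcendental.CurvePeriodsGmLoopsProofs
import Literature.NumberTheory.Transcendental.LindemannWeierstrassProofs
import Literature.NumberTheory.Transcendental.KZCalculus
import Summits.KontsevichZagierPeriods.KontsevichZagierPeriods.Theorems.GammaHodgeSector.Negative.Algebraicity

/-!
# `CurvePeriodsTransfer` (stmt-KontsevichZagierPeriods-11129) — negative knowledge, part 5: the transfer must replace paths

Support file for the crux `SymplecticScissors.CurvePeriodsTransfer` (cdisprove seat, cycle 2; work file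
`Cruxes/CurvePeriodsTransfer/Disproof.lean` §2c, §11).

* §1 Consequence of "`ℚ`-semialgebraic functions take ALGEBRAIC values at rational points"
  (`GammaHodgeSectorNegative.isAlgebraic_apply_ratCast`, landed in `Theorems/GammaHodgeSector/Negative/Algebraicity.lean`,
  imported — not re-proved): no 1-dimensional representation realises `λ · 𝟙` for a transcendental real `λ`
  (`isAlgebraic_of_rep_const`, `no_rep_realises_transcendental_const`), so the clause `∀ l, IsAlgebraic ℚ (a l)` of the
  antecedent's conclusion is CONSUMED by any realisation functional.
* §2 **The transfer must REPLACE paths.** The `C¹` symbol `piSymbol = (𝔸¹, dx, t ↦ t + (π − 1)b(t))`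
  (`b(t) = −4t³ + 6t² − 2t`), one R3-step from the unit symbol (`piSymbol_sub_unit_isElementary'`), has literal
  real realisation integrand `t ↦ Re(dx(γ′(t)))` equal to `π` at `t = ½` (`realIntegrand_piSymbol_half`); hence NO
  `IntegralRep 1` on the unit interval carries it (`no_rep_realises_piSymbol`, `not_exists_rep_realising_piSymbol`):
  the realisation `Θ` of a proof of the crux cannot be "integrate the literal pull-back" on Huber–Wüstholz's `C¹`
  symbols — every line pays for a path-replacement step (retraction, inscription or certificate surgery), already on
  the affine line.
[Kontsevich–Zagier 2001, §1.1; Huber–Wüstholz 2022, §13.1]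
-/

noncomputable section

open scoped BigOperators
open Set MeasureTheory Complex MvPolynomial intervalIntegral
open Literature.NumberTheory.Transcendental Literature.NumberTheory.Transcendental.CurvePeriods
open Literature.ModelTheory.ExponentialFields (IsSemialgebraic)

namespace Summit.KontsevichZagierPeriods.SymplecticScissors.CurvePeriodsTransferNegative

open Summit.KontsevichZagierPeriods.GammaHodgeSectorNegative (isAlgebraic_apply_ratCast)

/-! ## §1 No representation realises a transcendental constant -/

section ScalarAlgebraicity

/-- **No 1-dimensional representation realises a transcendental constant**: if `r : IntegralRep 1` has
domain `(0,1)` and integrand `≡ λ` there, then `λ` is algebraic. Hence the Θ-realisation of the transfer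
needs the certificate scalars `aₗ` of the antecedent's conclusion to be algebraic: that clause of
`HuberWustholzCurvePeriods` is USED, not decorative, for this proof route. [folklore] -/
theorem isAlgebraic_of_rep_const (r : KZ.IntegralRep 1) (c : ℝ)
    (hd : r.domain = {z | z 0 ∈ Set.Ioo 0 1}) (hi : ∀ z ∈ r.domain, r.integrand z = c) :
    IsAlgebraic ℚ c := by
  have hsa : IsSemialgebraicFunOn ℚ r.domain (fun _ => c) :=
    r.isSemialgebraicFunOn_integrand.congr (fun z hz => hi z hz)
  have hz : (fun i : Fin 1 => ((fun _ : Fin 1 => (1 / 2 : ℚ)) i : ℝ)) ∈ r.domain := by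
    rw [hd]
    simp only [mem_setOf_eq, Set.mem_Ioo]
    norm_num
  exact isAlgebraic_apply_ratCast hsa (fun _ => (1 / 2 : ℚ)) hz

/-- In particular no representation realises `λ · 𝟙` (`𝟙 = (𝔸¹, dx, [0,1])`, integrand `Re(λ·1·1) = λ`)
for a transcendental real `λ`. [folklore] -/
theorem no_rep_realises_transcendental_const {c : ℝ} (hc : Transcendental ℚ c) (r : KZ.IntegralRep 1)
    (hd : r.domain = {z | z 0 ∈ Set.Ioo 0 1}) (hi : ∀ z ∈ r.domain, r.integrand z = c) : False :=
  hc (isAlgebraic_of_rep_const r c hd hi)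

end ScalarAlgebraicity

/-! ## §2 The transfer must REPLACE paths: a `C¹` symbol whose literal real realisation is not a KZ representation -/

/-- The bump `b(t) = −4t³ + 6t² − 2t`: `b(0) = b(1) = 0`, `b′(½) = 1`. [folklore] -/
def bump (t : ℝ) : ℝ := -4 * t ^ 3 + 6 * t ^ 2 - 2 * t

/-- `t ↦ t + (π − 1)·b(t)`: a polynomial with a transcendental coefficient, from `0` to `1`. [folklore] -/
def piFun (t : ℝ) : ℝ := t + (Real.pi - 1) * bump t

/-- `piFun 0 = 0`. [folklore] -/
@[simp] theorem piFun_zero : piFun 0 = 0 := by simp [piFun, bump]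

/-- `piFun 1 = 1`. [folklore] -/
@[simp] theorem piFun_one : piFun 1 = 1 := by norm_num [piFun, bump]

/-- `piFun` is `C¹`. [folklore] -/
theorem contDiff_piFun : ContDiff ℝ 1 piFun := by
  unfold piFun bump
  fun_prop

/-- Derivative of the bump. [folklore] -/
theorem hasDerivAt_bump (t : ℝ) : HasDerivAt bump (-12 * t ^ 2 + 12 * t - 2) t := by
  have h1 := (hasDerivAt_pow 3 t).const_mul (-4 : ℝ)
  have h2 := (hasDerivAt_pow 2 t).const_mul (6 : ℝ)
  have h3 := (hasDerivAt_id' t).const_mul (2 : ℝ)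
  have h := (h1.add h2).sub h3
  have e : (-4 : ℝ) * (↑(3 : ℕ) * t ^ (3 - 1)) + 6 * (↑(2 : ℕ) * t ^ (2 - 1)) - 2 * 1 = -12 * t ^ 2 + 12 * t - 2 := by
    push_cast
    ring
  rw [e] at h
  exact h

/-- Derivative of `piFun`. [folklore] -/
theorem hasDerivAt_piFun (t : ℝ) :
    HasDerivAt piFun (1 + (Real.pi - 1) * (-12 * t ^ 2 + 12 * t - 2)) t :=
  (hasDerivAt_id' t).add ((hasDerivAt_bump t).const_mul (Real.pi - 1))

/-- The `C¹` path `t ↦ t + (π − 1)·b(t)` on the affine line, from `0` to `1` (algebraic end points,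
transcendental velocity `π` at `t = ½`). [folklore] -/
def piPath : CurvePath CurveData.affineLine where
  toFun t := fun _ => ((piFun t : ℝ) : ℂ)
  contDiffOn := (contDiff_pi' fun _ => Complex.ofRealCLM.contDiff.comp contDiff_piFun).contDiffOn
  mem_points t _ := by simp
  algebraic_zero _ := by simpa using isAlgebraic_zero
  algebraic_one _ := by simpa using isAlgebraic_one

/-- The symbol `(𝔸¹, dx, piPath)`; its period is `1` and it differs from `𝟙` by ONE R3 instance
(`piSymbol_sub_unit_isElementary`), so Huber–Wüstholz certificates may route through it. [folklore] -/
def piSymbol : PeriodSymbol where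
  Z := CurveData.affineLine
  smooth := CurveData.isSmoothAffineCurve_affineLine
  ω := fun _ => 1
  ω_algebraic _ := hasAlgCoeffs_one
  γ := piPath

/-- `(piSymbol) − (P(γ(1)) − P(γ(0)))·𝟙` with `P = x₀` is an R3 instance. [folklore] -/
theorem piSymbol_sub_unit_isElementary :
    IsElementaryRelation (Finsupp.single piSymbol 1 -
      (eval (piPath.toFun 1) (X 0) - eval (piPath.toFun 0) (X 0)) • Finsupp.single PeriodSymbol.unit 1) := by
  have hX : HasAlgCoeffs (X 0 : MvPolynomial (Fin 1) ℂ) := hasAlgCoeffs_X 0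
  have hω : (fun _ : Fin 1 => (1 : MvPolynomial (Fin 1) ℂ)) = formD (X 0) := by
    funext i
    rw [Subsingleton.elim i 0]
    simp [formD]
  exact IsElementaryRelation.exact CurveData.affineLine CurveData.isSmoothAffineCurve_affineLine piPath (X 0) hX
    (fun _ => 1) (fun _ => hasAlgCoeffs_one) hω

/-- The boundary term is `1`: `piSymbol − 𝟙 ∈ R3`. [folklore] -/
theorem piSymbol_sub_unit_isElementary' :
    IsElementaryRelation (Finsupp.single piSymbol 1 - Finsupp.single PeriodSymbol.unit 1) := by
  have h := piSymbol_sub_unit_isElementary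
  have e : eval (piPath.toFun 1) (X 0 : MvPolynomial (Fin 1) ℂ) - eval (piPath.toFun 0) (X 0) = 1 := by
    simp [piPath]
  rwa [e, one_smul] at h

/-- THE LITERAL REAL REALISATION integrand of `a·(ω, γ)`: `t ↦ Re(a · Σᵢ ωᵢ(γ(t)) γᵢ′(t))` — the
function the cards' `Realises r a ω γ` asks `r` to carry on `(0,1)`. [folklore] -/
def realIntegrand (s : PeriodSymbol) (a : ℂ) (t : ℝ) : ℝ :=
  (a * ∑ i, eval (s.γ.toFun t) (s.ω i) * deriv (fun u => s.γ.toFun u i) t).re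

/-- Velocity of `piPath`. [folklore] -/
theorem deriv_piPath (t : ℝ) (i : Fin 1) :
    deriv (fun u => piPath.toFun u i) t = ((1 + (Real.pi - 1) * (-12 * t ^ 2 + 12 * t - 2) : ℝ) : ℂ) := by
  have h := (hasDerivAt_piFun t).ofReal_comp
  exact h.deriv

/-- The literal realisation integrand of `piSymbol`. [folklore] -/
theorem realIntegrand_piSymbol (t : ℝ) :
    realIntegrand piSymbol 1 t = 1 + (Real.pi - 1) * (-12 * t ^ 2 + 12 * t - 2) := by
  show ((1 : ℂ) * ∑ i : Fin 1, eval (piPath.toFun t) (1 : MvPolynomial (Fin 1) ℂ) *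
      deriv (fun u => piPath.toFun u i) t).re = _
  simp only [map_one, one_mul, Fin.sum_univ_one, deriv_piPath, Complex.ofReal_re]

/-- At the rational point `t = ½` the literal realisation integrand of `piSymbol` is `π`. [folklore] -/
theorem realIntegrand_piSymbol_half : realIntegrand piSymbol 1 (1 / 2) = Real.pi := by
  rw [realIntegrand_piSymbol]
  ring


/-- **No KZ representation realises `piSymbol` literally.** If `r : IntegralRep 1` on the open unit interval
had integrand `t ↦ Re(1 · dx(γ′(t))) = 1 + (π − 1)b′(t)`, then — a `ℚ`-semialgebraic function takes ALGEBRAIC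
values at rational points (`GammaHodgeSectorNegative.isAlgebraic_apply_ratCast`) — `π = r.integrand(½)` would be algebraic,
contradicting Lindemann (`transcendental_pi_holds`). So the transfer `Θ` CANNOT be the literal real realisation
on Huber–Wüstholz's `C¹` symbols: every line must REPLACE paths (retraction / inscription / certificate
surgery) before realising, even on the affine line, even for symbols one R3-step away from `𝟙`.
[cite: KontsevichZagier2001, §1.1] -/
theorem no_rep_realises_piSymbol (r : KZ.IntegralRep 1) (hd : r.domain = {z | z 0 ∈ Set.Ioo (0 : ℝ) 1})
    (hi : ∀ z ∈ r.domain, r.integrand z = realIntegrand piSymbol 1 (z 0)) : False := by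
  have hz : (fun i : Fin 1 => ((fun _ : Fin 1 => (1 / 2 : ℚ)) i : ℝ)) ∈ r.domain := by
    rw [hd]
    simp only [Set.mem_setOf_eq, Set.mem_Ioo]
    norm_num
  have halg := isAlgebraic_apply_ratCast r.isSemialgebraicFunOn_integrand (fun _ => (1 / 2 : ℚ)) hz
  rw [hi _ hz] at halg
  have e : ((fun _ : Fin 1 => (1 / 2 : ℚ)) (0 : Fin 1) : ℝ) = 1 / 2 := by norm_num
  rw [e, realIntegrand_piSymbol_half] at halg
  exact transcendental_pi_holds halg

/-- The same, phrased as the cards' `Realises r a ω γ` predicate (domain clause + integrand clause). -/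
theorem not_exists_rep_realising_piSymbol :
    ¬ ∃ r : KZ.IntegralRep 1, r.domain = {z | z 0 ∈ Set.Ioo (0 : ℝ) 1} ∧
      ∀ z ∈ r.domain, r.integrand z =
        ((1 : ℂ) * ∑ i, eval (piSymbol.γ.toFun (z 0)) (piSymbol.ω i) *
          deriv (fun u => piSymbol.γ.toFun u i) (z 0)).re := by
  rintro ⟨r, hd, hi⟩
  exact no_rep_realises_piSymbol r hd hi



end Summit.KontsevichZagierPeriods.SymplecticScissors.CurvePeriodsTransferNegative

end
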